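import Summits.QuantumAdvantage.AdviceFreeQNC0.CubeCover
import HarnessLib

/-!
# Cell qa-qnc0 (rung F-Q1, route RingFrame, crux α, line `product`): T6 unconditional — far-set
# balance at every fixed column degree, and the `D = 2` unit test `LevelSetD2`

Consequences of `cubeCover` (`CubeCover.lean`) and `fsbDeg_of_cubeCover` (`CubeTransfer.lean`),
planner qa-qnc0-p1's THEOREM-TARGET T6 (HOME/qa-qnc0-p1/ROUND-8.md §1(c),(d), asks P7(c), P6f):

* `fsbDeg_cubes : ∀ D, ∀ τ > 0, FSBDeg D 2^{D+1} 2^{−D−4} τ 0` — FAR-SET BALANCE at every fixed column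
  degree `D` with the dual-distance constants (sandwich ratio `2^{D+1}`, `κ' = 2^{−D−4}`, no slack),
  UNCONDITIONALLY: for `L, L' ≥ L₀(D)`, every column-degree-`D` map `Γ` and every class `r`,
  `2^{−D−4}·#FAR_τ ≤ #(FAR_{τ/2^{D+1}} ∩ cls r)`.
* `far_eq_empty_of_cubeCoverAt` / `levelSet_fixedDeg`: the threshold form at the EXACT pure cap — for
  sandwich ratio `c ≥ 2^{D+1} − 1` and `L ≥ L₀(D, η)`: if class `r` is `(τ/c)`-near off a set `B` with
  `(2^{D+1} − 1)·#B ≤ (1 − η)·#cls r`, then NO row is `τ`-far.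
* `levelSetD2` (ask P6f, the first open fixed-`D` case after `LevelSetD1` p460506, in the same shape):
  column degree `2`, ratio `c ≥ 7 = 2³ − 1` (necessary by `DualDistanceCount` p466906, TARGET
  §20.9(c)), `48·#(cls r ∖ NEAR_{τ/c}) ≤ 2^L ⇒ FAR_τ = ∅`.

So the pure level-set method is completely mapped in the kernel: cap `2^{D+1} − 1` (p466906) attained
at every `D` (this file).  WHAT THIS IS NOT: the constants decay like `2^{−Θ(D)}` — this is a
fixed-degree theorem schema (and, through `LDMAAddOfFSB`/`ProductOfLDMAAdd`, a weak-gap statement at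
degree `≤ ½ log₂ n`), NOT `FSB` at polylog degree, NOT the constant-gap `RingHardLogDeg`, nothing on
α or on the separation.
-/

noncomputable section

namespace Summit.QuantumAdvantage.AdviceFreeQNC0

open Finset
open Literature.Computability.MetaComplexity Literature.Computability.MetaComplexity.Smolensky

/-- **T6, unconditional**: far-set balance at every fixed column degree `D` with the dual-distance
constants, `FSBDeg D 2^{D+1} 2^{−D−4} τ 0` for every `τ > 0`. -/
theorem fsbDeg_cubes (D : ℕ) (τ : ℝ) (hτ : 0 < τ) :
    FSBDeg D ((2 : ℝ) ^ (D + 1)) (1 / (2 : ℝ) ^ (D + 4)) τ 0 :=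
  fsbDeg_of_cubeCover D (CubeChar.cubeCover D (by norm_num)) τ hτ

/-- T6 in the shape of the hypothesis of `FSBDegOfCubeCover`, all hypotheses discharged. -/
theorem fsbDeg_cubes' (D : ℕ) (τ : ℝ) (hτ : 0 < τ) :
    FSBDeg D ((2 : ℝ) ^ (D + 1)) (1 / (2 : ℝ) ^ (D + 4)) τ 0 :=
  fsbDegOfCubeCover cubeIdentity distFailXor3 D (CubeChar.cubeCover D (by norm_num)) τ hτ

/-- **The threshold form at the exact pure cap.** If cubes cover at length `L` with margin `η`, then
for every column-degree-`D` map, ratio `c ≥ 2^{D+1} − 1` and class `r`: when class `r` is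
`(τ/c)`-near off a set `B` with `(2^{D+1} − 1)·#B ≤ (1 − η)·#cls r`, no row is `τ`-far. -/
theorem far_eq_empty_of_cubeCoverAt {L L' D : ℕ} {η : ℝ} (hcov : CubeCoverAt L D η)
    (Γ : (Fin L → Bool) → (Fin L' → Bool) → Bool) (hΓ : ∀ v, HasDeg (fun u => Γ u v) D)
    {c τ : ℝ} (hc : (2 : ℝ) ^ (D + 1) - 1 ≤ c) (hτ : 0 < τ) (r : ℕ)
    (hdens : ((2 : ℝ) ^ (D + 1) - 1) * ((cls L r \ near D Γ (τ / c)).card : ℝ) ≤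
      (1 - η) * ((cls L r).card : ℝ)) :
    far D Γ τ = ∅ := by
  set A := cls L r ∩ near D Γ (τ / c) with hA
  have hAsub : A ⊆ cls L r := Finset.inter_subset_left
  have hsd : cls L r \ A = cls L r \ near D Γ (τ / c) := by
    ext u
    simp only [hA, Finset.mem_sdiff, Finset.mem_inter, not_and]
    exact ⟨fun ⟨h1, h2⟩ => ⟨h1, h2 h1⟩, fun ⟨h1, h2⟩ => ⟨h1, fun _ => h2⟩⟩
  have hM1 : (1 : ℝ) ≤ (2 : ℝ) ^ (D + 1) - 1 := by
    have : (2 : ℝ) ≤ (2 : ℝ) ^ (D + 1) := by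
      calc (2 : ℝ) = 2 ^ 1 := by norm_num
        _ ≤ 2 ^ (D + 1) := pow_le_pow_right₀ (by norm_num) (by omega)
    linarith
  have hcpos : 0 < c := by linarith
  rw [Finset.eq_empty_iff_forall_notMem]
  intro x hx
  obtain ⟨a, ha⟩ := hcov r A hAsub (by rw [hsd]; exact hdens) x
  have hle := distFail_le_sum_cubeVertex Γ hΓ x a
  set P := (univ : Finset (Finset (Fin (D + 1)))).filter (fun S => S.Nonempty) with hP
  have hPcard : (P.card : ℝ) ≤ (2 : ℝ) ^ (D + 1) - 1 := by
    have h3 := card_filter_nonempty_add_one D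
    rw [← hP] at h3
    have h4 : ((P.card + 1 : ℕ) : ℝ) = ((2 ^ (D + 1) : ℕ) : ℝ) := by exact_mod_cast h3
    push_cast at h4
    linarith
  have hlt : ∀ S ∈ P, (distFail D (Γ (cubeVertex x a S)) : ℝ) < τ / c * (2 : ℝ) ^ L' := by
    intro S hS
    have hmem := ha S (Finset.mem_filter.1 hS).2
    rw [hA, Finset.mem_inter] at hmem
    have h := hmem.2
    unfold near at h
    exact (Finset.mem_filter.1 h).2
  have hsum : ((∑ S ∈ P, distFail D (Γ (cubeVertex x a S)) : ℕ) : ℝ) < τ * (2 : ℝ) ^ L' := by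
    by_cases hPe : P = ∅
    · rw [hPe, Finset.sum_empty]; push_cast; positivity
    · push_cast
      calc ∑ S ∈ P, (distFail D (Γ (cubeVertex x a S)) : ℝ)
          < ∑ _S ∈ P, τ / c * (2 : ℝ) ^ L' :=
            Finset.sum_lt_sum_of_nonempty (Finset.nonempty_iff_ne_empty.2 hPe) hlt
        _ = (P.card : ℝ) * (τ / c * (2 : ℝ) ^ L') := by rw [Finset.sum_const, nsmul_eq_mul]
        _ ≤ ((2 : ℝ) ^ (D + 1) - 1) * (τ / c * (2 : ℝ) ^ L') :=
            mul_le_mul_of_nonneg_right hPcard (by positivity)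
        _ ≤ c * (τ / c * (2 : ℝ) ^ L') := mul_le_mul_of_nonneg_right hc (by positivity)
        _ = τ * (2 : ℝ) ^ L' := by field_simp
  have hxfar : τ * (2 : ℝ) ^ L' ≤ (distFail D (Γ x) : ℝ) := by
    unfold far at hx; exact (Finset.mem_filter.1 hx).2
  have hle' : (distFail D (Γ x) : ℝ) ≤ ((∑ S ∈ P, distFail D (Γ (cubeVertex x a S)) : ℕ) : ℝ) := by
    exact_mod_cast hle
  linarith

/-- **The fixed-degree level-set theorem** (all `D`, exact cap): for ratio `c ≥ 2^{D+1} − 1`, every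
`τ > 0` and margin `η > 0` there is `L₀` such that for `L ≥ L₀` and any `L'`, every column-degree-`D`
map whose class `r` is `(τ/c)`-near off a set `B` with `(2^{D+1} − 1)·#B ≤ (1 − η)·#cls r` has no
`τ`-far row at all. -/
theorem levelSet_fixedDeg (D : ℕ) {c τ η : ℝ} (hc : (2 : ℝ) ^ (D + 1) - 1 ≤ c) (hτ : 0 < τ)
    (hη : 0 < η) :
    ∃ L₀ : ℕ, ∀ L L' : ℕ, L₀ ≤ L →
      ∀ Γ : (Fin L → Bool) → (Fin L' → Bool) → Bool, (∀ v, HasDeg (fun u => Γ u v) D) → ∀ r : ℕ,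
        ((2 : ℝ) ^ (D + 1) - 1) * ((cls L r \ near D Γ (τ / c)).card : ℝ) ≤
          (1 - η) * ((cls L r).card : ℝ) → far D Γ τ = ∅ := by
  obtain ⟨L₀, hL₀⟩ := CubeChar.cubeCover D hη
  exact ⟨L₀, fun L L' hL Γ hΓ r hdens => far_eq_empty_of_cubeCoverAt (hL₀ L hL) Γ hΓ hc hτ r hdens⟩

/-- **`LevelSetD2`** (planner qa-qnc0-p1 ask P6f, the shape of `LevelSetD1`): for column degree `2`
and sandwich ratio `c ≥ 7`, if class `r` is `(τ/c)`-near on all but `2^L/48` rows then NO row is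
`τ`-far (for `L` large).  The ratio `7 = 2³ − 1` is forced for pure arguments (`DualDistanceCount`). -/
theorem levelSetD2 : ∀ c τ : ℝ, 7 ≤ c → 0 < τ → ∃ L₀ : ℕ, ∀ L L' : ℕ, L₀ ≤ L →
    ∀ Γ : (Fin L → Bool) → (Fin L' → Bool) → Bool, (∀ v, HasDeg (fun u => Γ u v) 2) → ∀ r : ℕ,
      (48 : ℝ) * ((cls L r \ near 2 Γ (τ / c)).card : ℝ) ≤ (2 : ℝ) ^ L → far 2 Γ τ = ∅ := by
  intro c τ hc hτ
  obtain ⟨L₀, hL₀⟩ := levelSet_fixedDeg 2 (c := c) (τ := τ) (η := 1 / 2) (by norm_num; linarith) hτ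
    (by norm_num)
  refine ⟨max L₀ 4, fun L L' hL Γ hΓ r hB => hL₀ L L' (le_trans (le_max_left _ _) hL) Γ hΓ r ?_⟩
  have hL4 : 4 ≤ L := le_trans (le_max_right _ _) hL
  have hcls := three_mul_card_cls_ge L r
  have h16 : (16 : ℝ) ≤ (2 : ℝ) ^ L := by
    calc (16 : ℝ) = 2 ^ 4 := by norm_num
      _ ≤ 2 ^ L := pow_le_pow_right₀ (by norm_num) hL4
  norm_num
  nlinarith

end Summit.QuantumAdvantage.AdviceFreeQNC0

end
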